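import Literature.Analysis.Matrix.GurvitsPermanentBound
import Literature.Computability.QuantumComplexity.XEBSampleComplexity
import HarnessLib

/-!
# Gurvits's permanent approximation algorithm: the sample-complexity bound (Aaronson–Arkhipov, Thm 66)

Topic `Literature/Computability/QuantumComplexity` (pub-qadeq lane, boson-sampling rows E-11…E-15 —
the classical ADDITIVE-error estimation of permanents / boson-sampling amplitudes).

HONEST FRAMING: instance-level adjudication of specific advantage claims; no claim about BQP vs
BPP or the summit. This file proves a Chebyshev bound for an average of i.i.d. bounded estimators.

## Source

S. Aaronson, A. Arkhipov, *The computational complexity of linear optics* [AaronsonArkhipov2011],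
full version arXiv:1011.3245, Appendix 12 (tex chunk p0059 of `lit read arxiv:1011.3245`):

"Theorem 66 (Gurvits's Permanent Approximation Algorithm [Gurvits 2005]). There exists a randomized
(classical) algorithm that takes a matrix `V ∈ ℂ^{n×n}` as input, runs in `O(n²/ε²)` time, and with
high probability, approximates `Per(V)` to within an additive error `±ε‖V‖ⁿ`."  Its proof: draw
`T = O(1/ε²)` independent uniform `x ∈ {−1,1}ⁿ`, output the mean of the Glynn estimators
`Rys_x(V)` (each computable in `O(n²)` time); unbiased by Lemma 63, range `|Rys_x(V)| ≤ ‖V‖ⁿ` by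
Lemma 64, so Chebyshev gives the error bound.

This file (namespace `Literature.Computability.QuantumComplexity.GurvitsEstimator`) formalises the
STATISTICAL content in the finite product-weight form of `XEBSampleComplexity.lean` (the tree's
Chebyshev lower tail `XEB.sum_weight_sum_le_sub_le_wvar` for `T` i.i.d. draws): with the uniform
weight `2^{-n}` on sign vectors,
* `wmean_reEst` / `wmean_imEst`: the real and imaginary parts of `Rys_x(V)` have means `Re Per V`,
  `Im Per V` (Lemma 63, `permanent_eq_avg_glynnEstimator`);
* `wvar_reEst_le` / `wvar_imEst_le`: their variances are `≤ c^{2n}` for any operator-norm bound `c`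
  (Lemma 64, `norm_glynnEstimator_le`);
* `sum_weight_abs_dev_ge_le`: two-sided Chebyshev for sums of `T` i.i.d. draws of a real statistic;
* `sum_weight_deviation_le` (**Theorem 66, statistics**): the product weight of the sample sequences
  `ω ∈ ({±1}ⁿ)^T` whose empirical mean misses `Per V` by at least `ε cⁿ` is `≤ 8/(T ε²)` — so
  `T ≥ 8/(δ ε²)` samples give additive error `< ε cⁿ` except with weight `≤ δ`.
NOT formalised: the `O(n²)` running time per sample, and measure-theoretic probability language
(the product weight IS the probability of the event under i.i.d. uniform sampling).

## References

* [AaronsonArkhipov2011] S. Aaronson, A. Arkhipov, STOC 2011, 333–342, doi:10.1145/1993636.1993682;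
  full version arXiv:1011.3245 / Theory of Computing 9 (2013), Appendix 12, Theorem 66.
* L. Gurvits, MFCS 2005, LNCS 3618, 447–458 (original source, as credited there).
-/

noncomputable section

open Finset Literature.Combinatorics.Enumerative Literature.Analysis.Matrix
open Literature.Computability.QuantumComplexity.XEB

namespace Literature.Computability.QuantumComplexity.GurvitsEstimator

variable {ι : Type*} [Fintype ι] [DecidableEq ι]

/-! ### The uniform sign-vector ensemble and the real/imaginary parts of the estimator -/

/-- The uniform weight `2^{-n}` on sign vectors `x ∈ {−1,1}ⁿ` (encoded by `s = {k : x_k = −1}`).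
[cite: AaronsonArkhipov2011, App. 12 Lemma 63 (E over x ∈ {−1,1}ⁿ)] -/
def signWeight (ι : Type*) [Fintype ι] : Finset ι → ℝ := fun _ => ((2 : ℝ) ^ Fintype.card ι)⁻¹

omit [DecidableEq ι] in
/-- The uniform weights are nonnegative. [cite: AaronsonArkhipov2011, App. 12 Lemma 63] -/
theorem signWeight_nonneg (s : Finset ι) : 0 ≤ signWeight ι s := by
  unfold signWeight; positivity

omit [DecidableEq ι] in
/-- The uniform weights sum to `1` (there are `2ⁿ` sign vectors). [cite: AaronsonArkhipov2011, App. 12 Lemma 63] -/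
theorem sum_signWeight : ∑ s : Finset ι, signWeight ι s = 1 := by
  simp only [signWeight, Finset.sum_const, Finset.card_univ, Fintype.card_finset, nsmul_eq_mul]
  push_cast
  exact mul_inv_cancel₀ (by positivity)

/-- Real part of the Glynn estimator `Rys_x(V)`. [cite: AaronsonArkhipov2011, App. 12 (Rys_x(V))] -/
def reEst (V : Matrix ι ι ℂ) (s : Finset ι) : ℝ := (glynnEstimator V s).re

/-- Imaginary part of the Glynn estimator `Rys_x(V)`. [cite: AaronsonArkhipov2011, App. 12 (Rys_x(V))] -/
def imEst (V : Matrix ι ι ℂ) (s : Finset ι) : ℝ := (glynnEstimator V s).im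

omit [DecidableEq ι] in
/-- The averaging factor `2^{-n}` as a real scalar inside `ℂ`. [folklore] -/
private theorem inv_two_pow_eq_ofReal :
    ((2 : ℂ) ^ Fintype.card ι)⁻¹ = ((((2 : ℝ) ^ Fintype.card ι)⁻¹ : ℝ) : ℂ) := by
  push_cast; rfl

/-- **Unbiasedness (Lemma 63), real part**: `E_x[Re Rys_x(V)] = Re Per(V)`.
[cite: AaronsonArkhipov2011, App. 12 Lemma 63] -/
theorem wmean_reEst (V : Matrix ι ι ℂ) : wmean (signWeight ι) (reEst V) = (V.permanent).re := by
  unfold wmean signWeight reEst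
  rw [← Finset.mul_sum, ← Complex.re_sum, permanent_eq_avg_glynnEstimator, inv_two_pow_eq_ofReal,
    Complex.re_ofReal_mul]

/-- **Unbiasedness (Lemma 63), imaginary part**: `E_x[Im Rys_x(V)] = Im Per(V)`.
[cite: AaronsonArkhipov2011, App. 12 Lemma 63] -/
theorem wmean_imEst (V : Matrix ι ι ℂ) : wmean (signWeight ι) (imEst V) = (V.permanent).im := by
  unfold wmean signWeight imEst
  rw [← Finset.mul_sum, ← Complex.im_sum, permanent_eq_avg_glynnEstimator, inv_two_pow_eq_ofReal,
    Complex.im_ofReal_mul]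

/-- Variance of a statistic bounded by `B` in absolute value is `≤ B²` (via `Var ≤ E[F²]`). [folklore] -/
private theorem wvar_le_of_abs_le {α : Type*} [Fintype α] {w : α → ℝ} (hw : ∀ a, 0 ≤ w a)
    (hw1 : ∑ a, w a = 1) {F : α → ℝ} {B : ℝ} (hF : ∀ a, |F a| ≤ B) : wvar w F ≤ B ^ 2 := by
  refine (wvar_le_sum_mul_sub_sq hw1 F 0).trans ?_
  calc ∑ a, w a * (F a - 0) ^ 2 ≤ ∑ a, w a * B ^ 2 := Finset.sum_le_sum fun a _ =>
        mul_le_mul_of_nonneg_left (by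
          rw [sub_zero, ← sq_abs]; exact pow_le_pow_left₀ (abs_nonneg _) (hF a) 2) (hw a)
    _ = B ^ 2 := by rw [← Finset.sum_mul, hw1, one_mul]

/-- **Range bound ⇒ variance bound (Lemma 64)**: `Var_x[Re Rys_x(V)] ≤ c^{2n}` whenever `‖Vx‖ ≤ c‖x‖`
for all `x`. [cite: AaronsonArkhipov2011, App. 12 Lemma 64 and proof of Theorem 66] -/
theorem wvar_reEst_le (V : Matrix ι ι ℂ) {c : ℝ} (hc : 0 ≤ c)
    (hV : ∀ x : ι → ℂ, ∑ i, ‖∑ j, V i j * x j‖ ^ 2 ≤ c ^ 2 * ∑ j, ‖x j‖ ^ 2) :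
    wvar (signWeight ι) (reEst V) ≤ (c ^ Fintype.card ι) ^ 2 :=
  wvar_le_of_abs_le signWeight_nonneg sum_signWeight fun s =>
    (Complex.abs_re_le_norm _).trans (norm_glynnEstimator_le V hc hV s)

/-- **Range bound ⇒ variance bound (Lemma 64)**, imaginary part: `Var_x[Im Rys_x(V)] ≤ c^{2n}`.
[cite: AaronsonArkhipov2011, App. 12 Lemma 64 and proof of Theorem 66] -/
theorem wvar_imEst_le (V : Matrix ι ι ℂ) {c : ℝ} (hc : 0 ≤ c)
    (hV : ∀ x : ι → ℂ, ∑ i, ‖∑ j, V i j * x j‖ ^ 2 ≤ c ^ 2 * ∑ j, ‖x j‖ ^ 2) :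
    wvar (signWeight ι) (imEst V) ≤ (c ^ Fintype.card ι) ^ 2 :=
  wvar_le_of_abs_le signWeight_nonneg sum_signWeight fun s =>
    (Complex.abs_im_le_norm _).trans (norm_glynnEstimator_le V hc hV s)

/-! ### Two-sided Chebyshev for `T` i.i.d. draws (product weights) -/

/-- **Two-sided Chebyshev for the sum of `T` i.i.d. draws of a real statistic**: the product weight of
the sequences with `|Σᵢ F(ωᵢ) − T·E[F]| ≥ a` is at most `2·T·Var[F]/a²` (the tree's one-sided bound
applied to `F` and to `−F`; the factor `2` is the price of the union bound).
[cite: AaronsonArkhipov2011, App. 12 proof of Theorem 66 (Chebyshev)] -/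
theorem sum_weight_abs_dev_ge_le {α : Type*} [Fintype α] (w : α → ℝ) (hw : ∀ a, 0 ≤ w a)
    (hw1 : ∑ a, w a = 1) (F : α → ℝ) (T : ℕ) {a : ℝ} (ha : 0 < a) :
    ∑ ω ∈ univ.filter (fun ω : Fin T → α => a ≤ |∑ i, F (ω i) - T * wmean w F|), ∏ i, w (ω i)
      ≤ 2 * (T * wvar w F / a ^ 2) := by
  classical
  set A := univ.filter (fun ω : Fin T → α => (∑ i, F (ω i)) ≤ T * wmean w F - a) with hA
  set B := univ.filter (fun ω : Fin T → α =>
    (∑ i, (fun b => -F b) (ω i)) ≤ T * wmean w (fun b => -F b) - a) with hB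
  have hmean : wmean w (fun b => -F b) = -wmean w F := by
    simp only [wmean, mul_neg, Finset.sum_neg_distrib]
  have hvar : wvar w (fun b => -F b) = wvar w F := by
    simp only [wvar, hmean]
    exact Finset.sum_congr rfl fun b _ => by ring
  have hsub : univ.filter (fun ω : Fin T → α => a ≤ |∑ i, F (ω i) - T * wmean w F|) ⊆ A ∪ B := by
    intro ω hω
    rw [Finset.mem_filter] at hω
    rw [Finset.mem_union, hA, hB, Finset.mem_filter, Finset.mem_filter, hmean]
    rcases le_abs.1 hω.2 with h | h
    · right
      refine ⟨Finset.mem_univ _, ?_⟩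
      simp only [Finset.sum_neg_distrib]
      linarith
    · left
      exact ⟨Finset.mem_univ _, by linarith⟩
  have hnn : ∀ ω : Fin T → α, 0 ≤ ∏ i, w (ω i) := fun ω => Finset.prod_nonneg fun i _ => hw _
  have hAle := sum_weight_sum_le_sub_le_wvar w hw hw1 F T ha
  have hBle := sum_weight_sum_le_sub_le_wvar w hw hw1 (fun b => -F b) T ha
  rw [hvar] at hBle
  have hunion := Finset.sum_union_inter (s₁ := A) (s₂ := B) (f := fun ω : Fin T → α => ∏ i, w (ω i))
  have hinter : 0 ≤ ∑ ω ∈ A ∩ B, ∏ i, w (ω i) := Finset.sum_nonneg fun ω _ => hnn ω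
  calc ∑ ω ∈ univ.filter (fun ω : Fin T → α => a ≤ |∑ i, F (ω i) - T * wmean w F|), ∏ i, w (ω i)
      ≤ ∑ ω ∈ A ∪ B, ∏ i, w (ω i) := Finset.sum_le_sum_of_subset_of_nonneg hsub fun ω _ _ => hnn ω
    _ ≤ ∑ ω ∈ A, ∏ i, w (ω i) + ∑ ω ∈ B, ∏ i, w (ω i) := by linarith
    _ ≤ 2 * (T * wvar w F / a ^ 2) := by rw [hA, hB]; linarith

/-! ### Theorem 66: the deviation weight of the empirical mean -/

/-- **Theorem 66 (Gurvits's permanent approximation algorithm), statistical content**: for any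
`c > 0` with `‖Vx‖ ≤ c‖x‖` for all `x`, any `ε > 0` and any number of samples `T ≥ 1`, the uniform
product weight of the sample sequences `ω ∈ ({−1,1}ⁿ)^T` for which the empirical mean
`(1/T) Σᵢ Rys_{ωᵢ}(V)` misses `Per(V)` by at least `ε cⁿ` is at most `8/(T ε²)` — "with high
probability, approximates `Per(V)` to within an additive error `±ε‖V‖ⁿ`" using `T = O(1/ε²)` samples
(take `T ≥ 8/(δε²)` for failure weight `≤ δ`). Proof as printed (Chebyshev), applied to the real and
imaginary parts. [cite: AaronsonArkhipov2011, App. 12 Theorem 66 (full version arXiv:1011.3245)] -/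
theorem sum_weight_deviation_le (V : Matrix ι ι ℂ) {c : ℝ} (hc : 0 < c)
    (hV : ∀ x : ι → ℂ, ∑ i, ‖∑ j, V i j * x j‖ ^ 2 ≤ c ^ 2 * ∑ j, ‖x j‖ ^ 2)
    (T : ℕ) (hT : 0 < T) {ε : ℝ} (hε : 0 < ε) :
    ∑ ω ∈ univ.filter (fun ω : Fin T → Finset ι =>
        ε * c ^ Fintype.card ι ≤ ‖(T : ℂ)⁻¹ * ∑ i, glynnEstimator V (ω i) - V.permanent‖),
      ∏ i, signWeight ι (ω i) ≤ 8 / (T * ε ^ 2) := by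
  classical
  set n := Fintype.card ι with hn
  set w := signWeight ι with hw
  have hTr : (0 : ℝ) < T := by exact_mod_cast hT
  have hcn : 0 < c ^ n := pow_pos hc n
  -- the threshold for each of the real and imaginary parts
  set a : ℝ := T * ε * c ^ n / Real.sqrt 2 with ha
  have h2 : (0 : ℝ) < Real.sqrt 2 := Real.sqrt_pos.2 two_pos
  have ha0 : 0 < a := by rw [ha]; positivity
  have ha2 : 2 * a ^ 2 = (T * ε * c ^ n) ^ 2 := by
    rw [ha, div_pow, Real.sq_sqrt zero_le_two]; ring
  -- the two one-coordinate events
  set Ere := univ.filter (fun ω : Fin T → Finset ι => a ≤ |∑ i, reEst V (ω i) - T * wmean w (reEst V)|)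
    with hEre
  set Eim := univ.filter (fun ω : Fin T → Finset ι => a ≤ |∑ i, imEst V (ω i) - T * wmean w (imEst V)|)
    with hEim
  have hsub : univ.filter (fun ω : Fin T → Finset ι =>
      ε * c ^ n ≤ ‖(T : ℂ)⁻¹ * ∑ i, glynnEstimator V (ω i) - V.permanent‖) ⊆ Ere ∪ Eim := by
    intro ω hω
    rw [Finset.mem_filter] at hω
    set D : ℂ := ∑ i, glynnEstimator V (ω i) - T * V.permanent with hD
    -- `‖(1/T) Σ − Per‖ = ‖D‖ / T`
    have hTD : (T : ℂ)⁻¹ * ∑ i, glynnEstimator V (ω i) - V.permanent = (T : ℂ)⁻¹ * D := by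
      rw [hD, mul_sub, ← mul_assoc, inv_mul_cancel₀ (by exact_mod_cast hT.ne'), one_mul]
    have hnormD : T * ε * c ^ n ≤ ‖D‖ := by
      have h := hω.2
      rw [hTD, norm_mul, norm_inv, Complex.norm_natCast] at h
      have := mul_le_mul_of_nonneg_left h hTr.le
      rw [mul_inv_cancel_left₀ hTr.ne'] at this
      calc (T : ℝ) * ε * c ^ n = T * (ε * c ^ n) := by ring
        _ ≤ ‖D‖ := this
    have hre : D.re = ∑ i, reEst V (ω i) - T * wmean w (reEst V) := by
      rw [hw, wmean_reEst, hD, Complex.sub_re, Complex.re_sum, ← Complex.ofReal_natCast,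
        Complex.re_ofReal_mul]
      rfl
    have him : D.im = ∑ i, imEst V (ω i) - T * wmean w (imEst V) := by
      rw [hw, wmean_imEst, hD, Complex.sub_im, Complex.im_sum, ← Complex.ofReal_natCast,
        Complex.im_ofReal_mul]
      rfl
    by_contra hnot
    rw [Finset.mem_union, not_or, hEre, hEim, Finset.mem_filter, Finset.mem_filter, ← hre, ← him] at hnot
    have h1 : |D.re| < a := by
      by_contra h; exact hnot.1 ⟨Finset.mem_univ _, not_lt.1 h⟩
    have h2' : |D.im| < a := by
      by_contra h; exact hnot.2 ⟨Finset.mem_univ _, not_lt.1 h⟩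
    have hsq : ‖D‖ ^ 2 < (T * ε * c ^ n) ^ 2 := by
      rw [Complex.sq_norm, Complex.normSq_apply, ← ha2]
      have e1 : D.re * D.re < a ^ 2 := by
        rw [← sq, ← sq_abs]; exact pow_lt_pow_left₀ h1 (abs_nonneg _) two_ne_zero
      have e2 : D.im * D.im < a ^ 2 := by
        rw [← sq, ← sq_abs]; exact pow_lt_pow_left₀ h2' (abs_nonneg _) two_ne_zero
      linarith
    have hlt : ‖D‖ < T * ε * c ^ n := lt_of_pow_lt_pow_left₀ 2 (by positivity) hsq
    exact absurd hnormD (not_le.2 hlt)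
  have hnn : ∀ ω : Fin T → Finset ι, 0 ≤ ∏ i, w (ω i) :=
    fun ω => Finset.prod_nonneg fun i _ => signWeight_nonneg _
  have hre_le := sum_weight_abs_dev_ge_le w signWeight_nonneg sum_signWeight (reEst V) T ha0
  have him_le := sum_weight_abs_dev_ge_le w signWeight_nonneg sum_signWeight (imEst V) T ha0
  have hvre := wvar_reEst_le V hc.le hV
  have hvim := wvar_imEst_le V hc.le hV
  have hunion := Finset.sum_union_inter (s₁ := Ere) (s₂ := Eim)
    (f := fun ω : Fin T → Finset ι => ∏ i, w (ω i))
  have hinter : 0 ≤ ∑ ω ∈ Ere ∩ Eim, ∏ i, w (ω i) := Finset.sum_nonneg fun ω _ => hnn ω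
  -- each part: `2 T Var / a² ≤ 2 T c^{2n} / a² = 4 / (T ε²)`
  have hpart : 2 * (T * (c ^ n) ^ 2 / a ^ 2) = 4 / (T * ε ^ 2) := by
    have ha2' : a ^ 2 = (T * ε * c ^ n) ^ 2 / 2 := by rw [← ha2]; ring
    rw [ha2']
    field_simp
    ring
  have hmono : ∀ v : ℝ, v ≤ (c ^ n) ^ 2 → 2 * (T * v / a ^ 2) ≤ 2 * (T * (c ^ n) ^ 2 / a ^ 2) := by
    intro v hv
    have : T * v / a ^ 2 ≤ T * (c ^ n) ^ 2 / a ^ 2 :=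
      div_le_div_of_nonneg_right (mul_le_mul_of_nonneg_left hv hTr.le) (by positivity)
    linarith
  calc ∑ ω ∈ univ.filter (fun ω : Fin T → Finset ι =>
          ε * c ^ n ≤ ‖(T : ℂ)⁻¹ * ∑ i, glynnEstimator V (ω i) - V.permanent‖), ∏ i, w (ω i)
      ≤ ∑ ω ∈ Ere ∪ Eim, ∏ i, w (ω i) :=
        Finset.sum_le_sum_of_subset_of_nonneg hsub fun ω _ _ => hnn ω
    _ ≤ ∑ ω ∈ Ere, ∏ i, w (ω i) + ∑ ω ∈ Eim, ∏ i, w (ω i) := by linarith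
    _ ≤ 2 * (T * (c ^ n) ^ 2 / a ^ 2) + 2 * (T * (c ^ n) ^ 2 / a ^ 2) :=
        add_le_add (hre_le.trans (hmono _ hvre)) (him_le.trans (hmono _ hvim))
    _ = 8 / (T * ε ^ 2) := by rw [hpart]; ring

end Literature.Computability.QuantumComplexity.GurvitsEstimator
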